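import Mathlib

/-!
# `FilamentSkeletonRss` · crux `SkeletonJ1G` (stmt-NavierStokesRegularity-27849) · line `near_straight_newton` ·
# stub `stub_straightDatum`, part 1/2: the exact thin profile and the datum's scaled slip (one real variable)

Tools for `FilamentSkeletonRssSkeletonJ1GStubStraightDatum.lean` (part 2/2, which proves the registered stub S1 with
`StraightDatumExists` unfolded verbatim).  This part is the ONE-VARIABLE calculus of the exact rational datum of the
strategist's design law (`Cruxes/SkeletonJ1/Lines/near_straight_newton_design.md` §2): the thin profile
`F(u) = (125/3)/(1 + u²) + u − 7/6` — `F(−3) = 0` is its UNIQUE zero, `|F(u)| ≥ |u + 3|/5`, `F′(−3) = 7/2`,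
`|F′| ≤ 128/3` — and the scaled slip of both lines of the datum, `W(s) = (125/36)/(1 + 36 s²) + s/2 − 7/72 = (1/12)·F(6s)`:
unique zero `s₀ = −1/2`, transversality `(1/10)|s + 1/2| ≤ |W(s)|` (`mw = 1/10`), supercritical slope
`W′(s₀) = 7/4 = 3/2 + 1/4` (`δ = 1/4`), global slope bound `|W′| ≤ 22` (`Λ = 22`).

CREDIT.  A port — restated for the explicit expressions, no `def`s, so that the file stays a pure proof file — of the
strategist's sorry-free `Cruxes/SkeletonJ1/Lines/near_straight_newton_datum.lean`
(planner-cstrat-stmt-NavierStokesRegularity-27413-s1-g2-0: `Fthin_*`, `Wthin_*`).  Lane ns-filament-19175-p1 (g11).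

HONEST FRAMING.  Elementary real analysis for a HYPOTHETICAL filament-skeleton datum on the NEGATIVE side of a MODEL
route; route-independent (no `Theses` import); nothing here is a claim about Navier–Stokes regularity or blow-up.
-/

set_option linter.dupNamespace false

noncomputable section

namespace Summit.NavierStokesRegularity.NavierStokesRegularity.Theorems.FilamentSkeletonRssSkeletonJ1GStubStraightDatumSlip

/-! ### §1 The thin exact profile `F(u) = (125/3)/(1+u²) + u − 7/6` (one real variable; port of the strategist's facts) -/

/-- `F > 0` to the right of `−3` (`F(u) ≥ u + 3` on `(−3, 3]`, `F(u) > u − 7/6` beyond). [folklore] -/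
theorem thinProfile_pos_of_gt {u : ℝ} (hu : -3 < u) : 0 < 125 / 3 / (1 + u ^ 2) + u - 7 / 6 := by
  have h1 : 0 < 1 + u ^ 2 := by positivity
  rcases le_or_gt u 3 with h3 | h3
  · have hsq : 1 + u ^ 2 ≤ 10 := by nlinarith
    have hb : 25 / 6 ≤ 125 / 3 / (1 + u ^ 2) := by
      rw [le_div_iff₀ h1]; nlinarith
    linarith
  · have hb : 0 < 125 / 3 / (1 + u ^ 2) := by positivity
    linarith

/-- `F < 0` to the left of `−3`. [folklore] -/
theorem thinProfile_neg_of_lt {u : ℝ} (hu : u < -3) : 125 / 3 / (1 + u ^ 2) + u - 7 / 6 < 0 := by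
  have h1 : 0 < 1 + u ^ 2 := by positivity
  have hsq : 10 < 1 + u ^ 2 := by nlinarith
  have hb : 125 / 3 / (1 + u ^ 2) < 25 / 6 := by
    rw [div_lt_iff₀ h1]; nlinarith
  linarith

/-- UNIQUE ZERO of the profile: `F(u) = 0 ↔ u = −3`. [folklore] -/
theorem thinProfile_eq_zero_iff {u : ℝ} : 125 / 3 / (1 + u ^ 2) + u - 7 / 6 = 0 ↔ u = -3 := by
  constructor
  · intro h
    by_contra hne
    rcases lt_or_gt_of_ne hne with hlt | hgt
    · exact absurd h (ne_of_lt (thinProfile_neg_of_lt hlt))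
    · exact absurd h (ne_of_gt (thinProfile_pos_of_gt hgt))
  · rintro rfl; norm_num

/-- QUANTITATIVE TRANSVERSALITY of the profile: `|u + 3|/5 ≤ |F(u)|`. [folklore] -/
theorem thinProfile_transversal (u : ℝ) : |u + 3| / 5 ≤ |125 / 3 / (1 + u ^ 2) + u - 7 / 6| := by
  have h1 : 0 < 1 + u ^ 2 := by positivity
  rcases lt_or_ge u (-3) with hlt | hge
  · have hsq : 10 < 1 + u ^ 2 := by nlinarith
    have hb : 125 / 3 / (1 + u ^ 2) < 25 / 6 := by
      rw [div_lt_iff₀ h1]; nlinarith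
    have hF : 125 / 3 / (1 + u ^ 2) + u - 7 / 6 < u + 3 := by linarith
    rw [abs_of_neg (by linarith : u + 3 < 0), abs_of_neg (by linarith : 125 / 3 / (1 + u ^ 2) + u - 7 / 6 < 0)]
    linarith
  rcases le_or_gt u 3 with hle | hgt
  · have hsq : 1 + u ^ 2 ≤ 10 := by nlinarith
    have hb : 25 / 6 ≤ 125 / 3 / (1 + u ^ 2) := by
      rw [le_div_iff₀ h1]; nlinarith
    have hF : u + 3 ≤ 125 / 3 / (1 + u ^ 2) + u - 7 / 6 := by linarith
    rw [abs_of_nonneg (by linarith : 0 ≤ u + 3), abs_of_nonneg (by linarith : 0 ≤ 125 / 3 / (1 + u ^ 2) + u - 7 / 6)]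
    linarith
  · have hb : 0 < 125 / 3 / (1 + u ^ 2) := by positivity
    have hF : u - 7 / 6 < 125 / 3 / (1 + u ^ 2) + u - 7 / 6 := by linarith
    rw [abs_of_nonneg (by linarith : 0 ≤ u + 3), abs_of_pos (by linarith : 0 < 125 / 3 / (1 + u ^ 2) + u - 7 / 6)]
    linarith

/-- The profile has derivative `F′(u) = 1 − (250/3)·u/(1+u²)²`. [folklore] -/
theorem hasDerivAt_thinProfile (u : ℝ) :
    HasDerivAt (fun x : ℝ => 125 / 3 / (1 + x ^ 2) + x - 7 / 6) (1 - 250 / 3 * u / (1 + u ^ 2) ^ 2) u := by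
  have hden : HasDerivAt (fun x : ℝ => 1 + x ^ 2) (2 * u) u := by
    have := (hasDerivAt_pow 2 u).const_add 1
    simpa using this
  have hne : 1 + u ^ 2 ≠ 0 := by positivity
  have h1 : HasDerivAt (fun x : ℝ => 125 / 3 * (1 + x ^ 2)⁻¹) (125 / 3 * (-(2 * u) / (1 + u ^ 2) ^ 2)) u :=
    (hden.inv hne).const_mul (125 / 3)
  have h3 : HasDerivAt (fun x : ℝ => 125 / 3 * (1 + x ^ 2)⁻¹ + x - 7 / 6)
      (125 / 3 * (-(2 * u) / (1 + u ^ 2) ^ 2) + 1) u := (h1.add (hasDerivAt_id u)).sub_const (7 / 6)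
  have hF : (fun x : ℝ => 125 / 3 / (1 + x ^ 2) + x - 7 / 6) = fun x : ℝ => 125 / 3 * (1 + x ^ 2)⁻¹ + x - 7 / 6 := by
    funext x; ring
  rw [hF]
  convert h3 using 1
  ring

/-- Crude global slope bound for the profile: `|F′(u)| ≤ 128/3` (sharp value `≈ 28.07`). [folklore] -/
theorem abs_thinProfile_deriv_le (u : ℝ) : |1 - 250 / 3 * u / (1 + u ^ 2) ^ 2| ≤ 128 / 3 := by
  have h2 : 0 < (1 + u ^ 2) ^ 2 := by positivity
  have key : |u| ≤ (1 + u ^ 2) ^ 2 / 2 := by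
    have hu : |u| ≤ (1 + u ^ 2) / 2 := by
      rw [abs_le]; constructor <;> nlinarith [sq_nonneg (u + 1), sq_nonneg (u - 1)]
    have hsq : (1 + u ^ 2) / 2 ≤ (1 + u ^ 2) ^ 2 / 2 := by nlinarith
    exact hu.trans hsq
  have hq : |250 / 3 * u / (1 + u ^ 2) ^ 2| ≤ 125 / 3 := by
    rw [abs_div, abs_mul, abs_of_pos h2, abs_of_pos (by norm_num : (0:ℝ) < 250 / 3), div_le_iff₀ h2]
    nlinarith
  have : |1 - 250 / 3 * u / (1 + u ^ 2) ^ 2| ≤ |(1:ℝ)| + |250 / 3 * u / (1 + u ^ 2) ^ 2| :=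
    abs_sub (1:ℝ) (250 / 3 * u / (1 + u ^ 2) ^ 2)
  have h1' : |(1:ℝ)| = 1 := abs_one
  linarith

/-! ### §2 The scaled slip `W(s) = (125/36)/(1+36s²) + s/2 − 7/72 = (1/12)·F(6s)` of the datum -/

/-- `W(s) = (1/12)·F(6s)`. [folklore] -/
theorem slip_eq_thinProfile (s : ℝ) :
    125 / 36 / (1 + 36 * s ^ 2) + s / 2 - 7 / 72 = 1 / 12 * (125 / 3 / (1 + (6 * s) ^ 2) + 6 * s - 7 / 6) := by
  have h : (1 : ℝ) + (6 * s) ^ 2 = 1 + 36 * s ^ 2 := by ring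
  rw [h]
  have hne : (1 : ℝ) + 36 * s ^ 2 ≠ 0 := by positivity
  field_simp
  ring

/-- UNIQUE ZERO of the scaled slip: `W(s) = 0 ↔ s = −1/2`. [folklore] -/
theorem slip_eq_zero_iff {s : ℝ} : 125 / 36 / (1 + 36 * s ^ 2) + s / 2 - 7 / 72 = 0 ↔ s = -1 / 2 := by
  rw [slip_eq_thinProfile]
  constructor
  · intro h
    have h' : 125 / 3 / (1 + (6 * s) ^ 2) + 6 * s - 7 / 6 = 0 := by
      rcases mul_eq_zero.mp h with h | h
      · norm_num at h
      · exact h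
    have := thinProfile_eq_zero_iff.mp h'
    linarith
  · rintro rfl; norm_num

/-- TRANSVERSALITY with `mw = 1/10`: `(1/10)·|s − (−1/2)| ≤ |W(s)|`. [folklore] -/
theorem slip_transversal (s : ℝ) :
    1 / 10 * |s - (-1 / 2)| ≤ |125 / 36 / (1 + 36 * s ^ 2) + s / 2 - 7 / 72| := by
  rw [slip_eq_thinProfile, abs_mul, abs_of_pos (by norm_num : (0:ℝ) < 1 / 12)]
  have hF := thinProfile_transversal (6 * s)
  have h6 : |6 * s + 3| = 6 * |s - (-1 / 2)| := by
    rw [show 6 * s + 3 = 6 * (s - (-1 / 2)) by ring, abs_mul, abs_of_pos (by norm_num : (0:ℝ) < 6)]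
  rw [h6] at hF
  linarith

/-- The scaled slip has derivative `W′(s) = ½·F′(6s)`. [folklore] -/
theorem hasDerivAt_slip (s : ℝ) :
    HasDerivAt (fun x : ℝ => 125 / 36 / (1 + 36 * x ^ 2) + x / 2 - 7 / 72)
      (1 / 2 * (1 - 250 / 3 * (6 * s) / (1 + (6 * s) ^ 2) ^ 2)) s := by
  have hfun : (fun x : ℝ => 125 / 36 / (1 + 36 * x ^ 2) + x / 2 - 7 / 72) =
      fun x : ℝ => 1 / 12 * (125 / 3 / (1 + (6 * x) ^ 2) + 6 * x - 7 / 6) := funext slip_eq_thinProfile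
  rw [hfun]
  have hin : HasDerivAt (fun x : ℝ => 6 * x) 6 s := by
    simpa using (hasDerivAt_id s).const_mul (6:ℝ)
  have hcomp : HasDerivAt (fun x : ℝ => 125 / 3 / (1 + (6 * x) ^ 2) + 6 * x - 7 / 6)
      ((1 - 250 / 3 * (6 * s) / (1 + (6 * s) ^ 2) ^ 2) * 6) s :=
    HasDerivAt.comp s (hasDerivAt_thinProfile (6 * s)) hin
  refine (hcomp.const_mul (1 / 12 : ℝ)).congr_deriv ?_
  ring

/-- SUPERCRITICAL SLOPE at the zero: `W′(−1/2) = 7/4 = 3/2 + 1/4`. [folklore] -/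
theorem deriv_slip_zero :
    deriv (fun x : ℝ => 125 / 36 / (1 + 36 * x ^ 2) + x / 2 - 7 / 72) (-1 / 2) = 3 / 2 + 1 / 4 := by
  rw [(hasDerivAt_slip (-1 / 2)).deriv]; norm_num

/-- GLOBAL SLOPE BOUND with `Λ = 22`: `|W′(s)| ≤ 22`. [folklore] -/
theorem abs_deriv_slip_le (s : ℝ) :
    |deriv (fun x : ℝ => 125 / 36 / (1 + 36 * x ^ 2) + x / 2 - 7 / 72) s| ≤ 22 := by
  rw [(hasDerivAt_slip s).deriv, abs_mul, abs_of_pos (by norm_num : (0:ℝ) < 1 / 2)]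
  have := abs_thinProfile_deriv_le (6 * s)
  linarith

end Summit.NavierStokesRegularity.NavierStokesRegularity.Theorems.FilamentSkeletonRssSkeletonJ1GStubStraightDatumSlip
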